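import Summits.Ventures.LatticeQCDFlow.Scaling.CollectorFloor

/-!
HONEST FRAMING: exact (Metropolis-corrected) sampling algorithms for lattice gauge theory; figures
of merit are autocorrelation/cost numbers at stated couplings and volumes; no continuum-physics
claim.

# DeathChainComparison — A STATISTIC THAT DROPS BY AT MOST ONE PER STEP, WITH PROBABILITY AT MOST `θ·G`, DOMINATES THE LINEAR PURE-DEATH CHAIN; THE DEATH CHAIN'S TWO
# EIGENFUNCTIONS AND CHEBYSHEV GIVE `P_{x₀}{G_n ≥ m} ≥ 1 − s/(s−m)²`, `s = G(x₀)(1−θ)ⁿ`, HENCE `d(n) ≥ 1 − s/(s−m)² − π{g ≥ m}` AND THE COUPON-COLLECTOR MIXING FLOOR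
# `t_mix(1/4) ≥ ((1−θ)/θ)·log(G(x₀)/(3(e+2)))` FOR EVERY `π` WITH `E_π g ≤ e`, `g ≥ G` (lean-2 GEN-45, ours)

Venture-side (OURS).  Cell `lqcd-flow` (pub-lqcd), unit `pub-lqcd-lean-2-g45`, 2026-08-31.  Chapter AE (the `log K` on the floor side of chapter AD's step law), file 1 — the generic
mechanism, for an ABSTRACT row-stochastic kernel `P` on a finite `X` and a statistic `G : X → ℕ` with `G ≤ K` such that (i) no transition lowers `G` by more than one
(`P x y ≠ 0 ⇒ G x ≤ G y + 1`) and (ii) from every state the probability of lowering it is at most `θ·G(x)` (`θ ≥ 0`, `θK ≤ 1`).  The comparison chain is the linear pure-death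
chain on `{0,…,K}` (from `j`, to `j−1` with probability `θj`) — the number of uncollected coupons when each step collects one of `K` coupons with probability `θ` each — written
def-free as an operator on test functions by the hypothesis-equation `(Qf)(j) = θj·f(j−1) + (1−θj)·f(j)` (`ℕ`-subtraction: at `j = 0` the first term has coefficient `0`).

* §1 the operator: `death_affine` ∕ `death_iter_affine` (constants, `j ↦ j` and `j ↦ j(j−1)` are eigenfunctions with eigenvalues `1`, `1−θ`, `1−2θ`), `death_le_of_le` ∕ `death_iter_le_of_le`
  (order on `[0,K]`), `death_monotoneOn` ∕ `death_iter_monotoneOn` (monotone test functions stay monotone); §2 **`death_iter_indicator_ge`** — Chebyshev: `(Qⁿ𝟙_{≥m})(j₀) ≥ 1 − s/(s−m)²`,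
  `s = j₀(1−θ)ⁿ`, `m < s`, `2θ ≤ 1`; §3 **`compare_step`**, **`compare_lawAt`** — `E_{μPⁿ}[f∘G] ≥ E_μ[(Qⁿf)∘G]` for every `f` monotone on `[0,K]`; **`compare_mass_ge`** —
  `(δ_{x₀}Pⁿ){G ≥ m} ≥ 1 − s/(s−m)²`, `s = G(x₀)(1−θ)ⁿ`; §4 **`compare_worstTvDist_ge`** — `d(n) ≥ 1 − s/(s−m)² − π{g ≥ m}` for any `g ≥ G` and any unit-mass `π ≥ 0`;
  **`compare_lt_mixingTime`** — `G(x₀)(1−θ)ⁿ ≥ 3(e+2)`, `E_π g ≤ e` ⇒ `n < t_mix(1/4)`; **`compare_mixingTime_ge`** — **`t_mix(1/4) ≥ ((1−θ)/θ)·log(G(x₀)/(3(e+2)))`**.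

Reading (no numerics implied): the coupon-collector lower bound of Levin–Peres–Wilmer (Lemma 7.13 with Prop. 7.14's Chebyshev step) freed from independence — any statistic that can
only be worn down one unit at a time at a rate proportional to its size survives the coupon-collector time in probability, whatever else the chain does.  Files 2–3 instantiate it
for the lumped star's cold `u`-particles (`θ = σa/K`) and for chapter U's homogeneous scheme (`θ = ta/K`).  Literature grade (cell rule): KNOWN MECHANISM (Levin–Peres–Wilmer §7.3.1),
NEW TYPING (stochastic comparison with a pure-death chain for an abstract kernel); nothing cited as a fact; no new bib keys.
-/

noncomputable section

open Finset Function
open Literature.Probability.MarkovChains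

namespace Summit.Ventures.LatticeQCDFlow.Scaling

/-! ## §1 The linear pure-death operator -/

section DeathOp
variable {Q : (ℕ → ℝ) → ℕ → ℝ} {θ : ℝ}

/-- The operator on an affine combination of `1`, `j` and `j(j−1)`: `Q(c₀ + c₁j + c₂j(j−1)) = c₀ + c₁(1−θ)j + c₂(1−2θ)j(j−1)` — the three eigenfunctions of the linear death chain.
[ours] -/
theorem death_affine (hQ : ∀ f j, Q f j = θ * j * f (j - 1) + (1 - θ * j) * f j) (c₀ c₁ c₂ : ℝ) :
    Q (fun j : ℕ => c₀ + c₁ * (j : ℝ) + c₂ * ((j : ℝ) * ((j : ℝ) - 1)))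
      = fun j : ℕ => c₀ + c₁ * (1 - θ) * (j : ℝ) + c₂ * (1 - 2 * θ) * ((j : ℝ) * ((j : ℝ) - 1)) := by
  funext j
  rw [hQ]
  cases j with
  | zero => simp
  | succ k =>
      simp only [Nat.add_sub_cancel, Nat.cast_add, Nat.cast_one]
      ring

/-- Iterated: `Qⁿ(c₀ + c₁j + c₂j(j−1)) = c₀ + c₁(1−θ)ⁿj + c₂(1−2θ)ⁿj(j−1)`. [ours] -/
theorem death_iter_affine (hQ : ∀ f j, Q f j = θ * j * f (j - 1) + (1 - θ * j) * f j) (n : ℕ) (c₀ c₁ c₂ : ℝ) :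
    Q^[n] (fun j : ℕ => c₀ + c₁ * (j : ℝ) + c₂ * ((j : ℝ) * ((j : ℝ) - 1)))
      = fun j : ℕ => c₀ + c₁ * (1 - θ) ^ n * (j : ℝ) + c₂ * (1 - 2 * θ) ^ n * ((j : ℝ) * ((j : ℝ) - 1)) := by
  induction n generalizing c₁ c₂ with
  | zero => funext j; simp
  | succ n ih =>
      rw [Function.iterate_succ_apply, death_affine hQ, ih]
      funext j
      ring

/-- Order on `[0,K]`: `f ≤ g` on `[0,K]`, `θ ≥ 0`, `θK ≤ 1` ⇒ `Qf ≤ Qg` on `[0,K]`. [ours] -/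
theorem death_le_of_le (hQ : ∀ f j, Q f j = θ * j * f (j - 1) + (1 - θ * j) * f j) (hθ0 : 0 ≤ θ) {K : ℕ} (hθK : θ * K ≤ 1)
    {f g : ℕ → ℝ} (hfg : ∀ j, j ≤ K → f j ≤ g j) : ∀ j, j ≤ K → Q f j ≤ Q g j := by
  intro j hj
  rw [hQ, hQ]
  have h1 : 0 ≤ θ * j := mul_nonneg hθ0 (Nat.cast_nonneg j)
  have h2 : 0 ≤ 1 - θ * j := by
    have : θ * (j : ℝ) ≤ θ * K := mul_le_mul_of_nonneg_left (by exact_mod_cast hj) hθ0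
    linarith
  have h3 := hfg (j - 1) (le_trans (Nat.sub_le j 1) hj)
  have h4 := hfg j hj
  nlinarith

/-- Iterated order on `[0,K]`. [ours] -/
theorem death_iter_le_of_le (hQ : ∀ f j, Q f j = θ * j * f (j - 1) + (1 - θ * j) * f j) (hθ0 : 0 ≤ θ) {K : ℕ} (hθK : θ * K ≤ 1)
    (n : ℕ) {f g : ℕ → ℝ} (hfg : ∀ j, j ≤ K → f j ≤ g j) : ∀ j, j ≤ K → (Q^[n] f) j ≤ (Q^[n] g) j := by
  induction n generalizing f g with
  | zero => simpa using hfg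
  | succ n ih =>
      rw [Function.iterate_succ_apply, Function.iterate_succ_apply]
      exact ih (death_le_of_le hQ hθ0 hθK hfg)

/-- Monotone test functions stay monotone on `[0,K]`: `Qf(i) ≤ f(i) ≤ f(j−1) ≤ Qf(j)` for `i < j ≤ K`. [ours] -/
theorem death_monotoneOn (hQ : ∀ f j, Q f j = θ * j * f (j - 1) + (1 - θ * j) * f j) (hθ0 : 0 ≤ θ) {K : ℕ} (hθK : θ * K ≤ 1)
    {f : ℕ → ℝ} (hf : ∀ i j, i ≤ j → j ≤ K → f i ≤ f j) : ∀ i j, i ≤ j → j ≤ K → Q f i ≤ Q f j := by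
  intro i j hij hjK
  rcases Nat.eq_or_lt_of_le hij with h | h
  · rw [h]
  · have hiK : i ≤ K := le_trans hij hjK
    -- `Qf(i) ≤ f(i)`
    have hup : Q f i ≤ f i := by
      rw [hQ]
      have h1 : 0 ≤ θ * i := mul_nonneg hθ0 (Nat.cast_nonneg i)
      have h3 := hf (i - 1) i (Nat.sub_le i 1) hiK
      nlinarith
    -- `f(j−1) ≤ Qf(j)`
    have hdown : f (j - 1) ≤ Q f j := by
      rw [hQ]
      have h2 : 0 ≤ 1 - θ * j := by
        have : θ * (j : ℝ) ≤ θ * K := mul_le_mul_of_nonneg_left (by exact_mod_cast hjK) hθ0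
        linarith
      have h3 := hf (j - 1) j (Nat.sub_le j 1) hjK
      nlinarith
    have hmid : f i ≤ f (j - 1) := hf i (j - 1) (by omega) (le_trans (Nat.sub_le j 1) hjK)
    linarith

/-- Iterated monotonicity on `[0,K]`. [ours] -/
theorem death_iter_monotoneOn (hQ : ∀ f j, Q f j = θ * j * f (j - 1) + (1 - θ * j) * f j) (hθ0 : 0 ≤ θ) {K : ℕ} (hθK : θ * K ≤ 1)
    (n : ℕ) {f : ℕ → ℝ} (hf : ∀ i j, i ≤ j → j ≤ K → f i ≤ f j) : ∀ i j, i ≤ j → j ≤ K → (Q^[n] f) i ≤ (Q^[n] f) j := by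
  induction n generalizing f with
  | zero => simpa using hf
  | succ n ih =>
      rw [Function.iterate_succ_apply]
      exact ih (death_monotoneOn hQ hθ0 hθK hf)

/-! ## §2 Chebyshev for the death chain -/

/-- **THE COUPON-COLLECTOR ESTIMATE FOR THE DEATH CHAIN:** from `j₀ ≤ K`, with `s = j₀(1−θ)ⁿ` and `m < s` (`0 ≤ θ`, `2θ ≤ 1`, `θK ≤ 1`),
**`(Qⁿ𝟙_{[m,∞)})(j₀) ≥ 1 − s/(s−m)²`** — the mean is `s`, the second factorial moment `j₀(j₀−1)(1−2θ)ⁿ ≤ s²`, so the variance is `≤ s`. [ours] -/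
theorem death_iter_indicator_ge (hQ : ∀ f j, Q f j = θ * j * f (j - 1) + (1 - θ * j) * f j) (hθ0 : 0 ≤ θ) (hθh : 2 * θ ≤ 1)
    {K : ℕ} (hθK : θ * K ≤ 1) {j₀ : ℕ} (hj₀ : j₀ ≤ K) (n : ℕ) {m : ℝ} (hms : m < (j₀ : ℝ) * (1 - θ) ^ n) :
    1 - (j₀ : ℝ) * (1 - θ) ^ n / ((j₀ : ℝ) * (1 - θ) ^ n - m) ^ 2 ≤ (Q^[n] (fun j => if m ≤ (j : ℝ) then (1 : ℝ) else 0)) j₀ := by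
  set s : ℝ := (j₀ : ℝ) * (1 - θ) ^ n with hs
  have hsm : 0 < s - m := by linarith
  have hsm2 : 0 < (s - m) ^ 2 := by positivity
  -- the quadratic minorant `q(j) = 1 − (j − s)²/(s − m)²` of the indicator
  have hq : ∀ j, j ≤ K → (1 - s ^ 2 / (s - m) ^ 2) + (-(1 - 2 * s) / (s - m) ^ 2) * (j : ℝ) + (-(1 / (s - m) ^ 2)) * ((j : ℝ) * ((j : ℝ) - 1))
      ≤ (if m ≤ (j : ℝ) then (1 : ℝ) else 0) := by
    intro j _
    have e : (1 - s ^ 2 / (s - m) ^ 2) + (-(1 - 2 * s) / (s - m) ^ 2) * (j : ℝ) + (-(1 / (s - m) ^ 2)) * ((j : ℝ) * ((j : ℝ) - 1))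
        = 1 - ((j : ℝ) - s) ^ 2 / (s - m) ^ 2 := by
      field_simp
      ring
    rw [e]
    by_cases hmj : m ≤ (j : ℝ)
    · rw [if_pos hmj]
      have : 0 ≤ ((j : ℝ) - s) ^ 2 / (s - m) ^ 2 := by positivity
      linarith
    · rw [if_neg hmj]
      push Not at hmj
      have h1 : s - m ≤ s - (j : ℝ) := by linarith
      have h2 : (s - m) ^ 2 ≤ ((j : ℝ) - s) ^ 2 := by nlinarith
      have h3 : 1 ≤ ((j : ℝ) - s) ^ 2 / (s - m) ^ 2 := by rw [le_div_iff₀ hsm2]; linarith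
      linarith
  have hle := death_iter_le_of_le hQ hθ0 hθK n hq j₀ hj₀
  rw [death_iter_affine hQ n] at hle
  beta_reduce at hle
  -- evaluate the minorant's image at `j₀`
  have hfac : (1 - 2 * θ) ^ n * ((j₀ : ℝ) * ((j₀ : ℝ) - 1)) ≤ s ^ 2 := by
    have h1 : 0 ≤ 1 - 2 * θ := by linarith
    have h2 : 1 - 2 * θ ≤ (1 - θ) ^ 2 := by nlinarith
    have h3 : (1 - 2 * θ) ^ n ≤ ((1 - θ) ^ 2) ^ n := pow_le_pow_left₀ h1 h2 n
    have h4 : (j₀ : ℝ) * ((j₀ : ℝ) - 1) ≤ (j₀ : ℝ) * j₀ := by nlinarith [Nat.cast_nonneg (α := ℝ) j₀]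
    have h5 : 0 ≤ ((1 - θ) ^ 2) ^ n := by positivity
    by_cases hj1 : 1 ≤ j₀
    · have h6 : 0 ≤ (j₀ : ℝ) * ((j₀ : ℝ) - 1) := mul_nonneg (Nat.cast_nonneg _) (by
        have : (1 : ℝ) ≤ j₀ := by exact_mod_cast hj1
        linarith)
      calc (1 - 2 * θ) ^ n * ((j₀ : ℝ) * ((j₀ : ℝ) - 1)) ≤ ((1 - θ) ^ 2) ^ n * ((j₀ : ℝ) * ((j₀ : ℝ) - 1)) :=
            mul_le_mul_of_nonneg_right h3 h6
        _ ≤ ((1 - θ) ^ 2) ^ n * ((j₀ : ℝ) * j₀) := mul_le_mul_of_nonneg_left h4 h5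
        _ = s ^ 2 := by rw [hs, ← pow_mul, mul_comm 2 n, pow_mul]; ring
    · have hj0 : j₀ = 0 := by omega
      subst hj0
      simp [hs]
  have e1 : (1 - s ^ 2 / (s - m) ^ 2) + (-(1 - 2 * s) / (s - m) ^ 2) * (1 - θ) ^ n * (j₀ : ℝ)
        + (-(1 / (s - m) ^ 2)) * (1 - 2 * θ) ^ n * ((j₀ : ℝ) * ((j₀ : ℝ) - 1))
      = 1 - ((1 - 2 * θ) ^ n * ((j₀ : ℝ) * ((j₀ : ℝ) - 1)) + s - s ^ 2) / (s - m) ^ 2 := by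
    rw [hs]
    field_simp
    ring
  rw [e1] at hle
  have h7 : ((1 - 2 * θ) ^ n * ((j₀ : ℝ) * ((j₀ : ℝ) - 1)) + s - s ^ 2) / (s - m) ^ 2 ≤ s / (s - m) ^ 2 :=
    div_le_div_of_nonneg_right (by linarith) hsm2.le
  linarith

end DeathOp

/-! ## §3 The comparison -/

section Compare
variable {X : Type*} [Fintype X] [DecidableEq X] {P : X → X → ℝ} {G : X → ℕ} {K : ℕ} {Q : (ℕ → ℝ) → ℕ → ℝ} {θ : ℝ}

omit [DecidableEq X] in
/-- **ONE STEP:** if `G` drops by at most one (`P x y ≠ 0 ⇒ G x ≤ G y + 1`) and the dropping probability is `≤ θ·G(x)`, then for every `f` monotone on `[0,K]` (`G ≤ K`),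
**`(P(f∘G))(x) ≥ (Qf)(G x)`**. [ours] -/
theorem compare_step (hQ : ∀ f j, Q f j = θ * j * f (j - 1) + (1 - θ * j) * f j) (hP : IsRowStochastic P)
    (hGK : ∀ x, G x ≤ K) (hdrop : ∀ x y, P x y ≠ 0 → G x ≤ G y + 1)
    (hdown : ∀ x, ∑ y ∈ univ.filter (fun y => G y + 1 = G x), P x y ≤ θ * G x)
    {f : ℕ → ℝ} (hf : ∀ i j, i ≤ j → j ≤ K → f i ≤ f j) (x : X) : Q f (G x) ≤ ∑ y, P x y * f (G y) := by
  have hP0 := hP.1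
  -- pointwise: `P x y · f(G y) ≥ P x y · (f(G x) − 𝟙{G y + 1 = G x}(f(G x) − f(G x − 1)))`
  have key : ∀ y, P x y * (f (G x) - (if G y + 1 = G x then f (G x) - f (G x - 1) else 0)) ≤ P x y * f (G y) := by
    intro y
    by_cases h1 : G y + 1 = G x
    · rw [if_pos h1]
      have : G x - 1 = G y := by omega
      rw [this]; linarith
    · rw [if_neg h1, sub_zero]
      by_cases h0 : P x y = 0
      · rw [h0, zero_mul, zero_mul]
      · have h2 : G x ≤ G y := by have := hdrop x y h0; omega
        exact mul_le_mul_of_nonneg_left (hf _ _ h2 (hGK y)) (hP0 x y)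
  have hsum := sum_le_sum fun y (_ : y ∈ univ) => key y
  have e : ∑ y, P x y * (f (G x) - (if G y + 1 = G x then f (G x) - f (G x - 1) else 0))
      = f (G x) - (f (G x) - f (G x - 1)) * ∑ y ∈ univ.filter (fun y => G y + 1 = G x), P x y := by
    simp_rw [mul_sub, sum_sub_distrib, ← sum_mul, hP.2 x, one_mul, Finset.sum_filter, mul_ite, mul_zero]
    congr 1
    rw [mul_sum]
    exact sum_congr rfl fun y _ => by split_ifs <;> ring
  rw [e] at hsum
  have hdiff : 0 ≤ f (G x) - f (G x - 1) := by linarith [hf (G x - 1) (G x) (Nat.sub_le _ 1) (hGK x)]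
  have h3 : (f (G x) - f (G x - 1)) * ∑ y ∈ univ.filter (fun y => G y + 1 = G x), P x y ≤ (f (G x) - f (G x - 1)) * (θ * G x) :=
    mul_le_mul_of_nonneg_left (hdown x) hdiff
  have e2 : Q f (G x) = f (G x) - (f (G x) - f (G x - 1)) * (θ * G x) := by rw [hQ]; ring
  linarith

omit [DecidableEq X] in
/-- `E_{μP}[F] = E_μ[PF]`. [ours] -/
theorem compare_stepLaw_expect (F : X → ℝ) (μ : X → ℝ) : ∑ y, stepLaw P μ y * F y = ∑ x, μ x * ∑ y, P x y * F y := by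
  unfold stepLaw
  simp_rw [sum_mul, mul_sum]
  rw [sum_comm]
  exact sum_congr rfl fun x _ => sum_congr rfl fun y _ => by ring

omit [DecidableEq X] in
/-- **ALONG THE CHAIN:** for every `f` monotone on `[0,K]`, every start law `μ ≥ 0` and every `n`, **`E_{μPⁿ}[f∘G] ≥ E_μ[(Qⁿf)∘G]`** (`θ ≥ 0`, `θK ≤ 1`). [ours] -/
theorem compare_lawAt (hQ : ∀ f j, Q f j = θ * j * f (j - 1) + (1 - θ * j) * f j) (hθ0 : 0 ≤ θ) (hθK : θ * K ≤ 1) (hP : IsRowStochastic P)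
    (hGK : ∀ x, G x ≤ K) (hdrop : ∀ x y, P x y ≠ 0 → G x ≤ G y + 1)
    (hdown : ∀ x, ∑ y ∈ univ.filter (fun y => G y + 1 = G x), P x y ≤ θ * G x) (n : ℕ)
    {f : ℕ → ℝ} (hf : ∀ i j, i ≤ j → j ≤ K → f i ≤ f j) {μ : X → ℝ} (hμ : ∀ x, 0 ≤ μ x) :
    ∑ x, μ x * (Q^[n] f) (G x) ≤ ∑ y, lawAt P μ n y * f (G y) := by
  induction n generalizing f with
  | zero => simp [lawAt_zero]
  | succ n ih =>
      rw [lawAt_succ, compare_stepLaw_expect]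
      have hl0 : ∀ y, 0 ≤ lawAt P μ n y := lawAt_nonneg hP hμ n
      calc ∑ x, μ x * (Q^[n + 1] f) (G x) = ∑ x, μ x * (Q^[n] (Q f)) (G x) := by rw [Function.iterate_succ_apply]
        _ ≤ ∑ y, lawAt P μ n y * (Q f) (G y) := ih (death_monotoneOn hQ hθ0 hθK hf)
        _ ≤ ∑ y, lawAt P μ n y * ∑ z, P y z * f (G z) :=
            sum_le_sum fun y _ => mul_le_mul_of_nonneg_left (compare_step hQ hP hGK hdrop hdown hf y) (hl0 y)

/-- **THE MASS OF `{G ≥ m}` IN PROBABILITY:** from `x₀`, with `s = G(x₀)(1−θ)ⁿ`, `m < s` (`0 ≤ θ`, `2θ ≤ 1`, `θK ≤ 1`, `G ≤ K`),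
**`(δ_{x₀}Pⁿ){y : m ≤ G y} ≥ 1 − s/(s−m)²`**. [ours] -/
theorem compare_mass_ge (hQ : ∀ f j, Q f j = θ * j * f (j - 1) + (1 - θ * j) * f j) (hθ0 : 0 ≤ θ) (hθh : 2 * θ ≤ 1) (hθK : θ * K ≤ 1)
    (hP : IsRowStochastic P) (hGK : ∀ x, G x ≤ K) (hdrop : ∀ x y, P x y ≠ 0 → G x ≤ G y + 1)
    (hdown : ∀ x, ∑ y ∈ univ.filter (fun y => G y + 1 = G x), P x y ≤ θ * G x) (x₀ : X) (n : ℕ) {m : ℝ}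
    (hms : m < (G x₀ : ℝ) * (1 - θ) ^ n) :
    1 - (G x₀ : ℝ) * (1 - θ) ^ n / ((G x₀ : ℝ) * (1 - θ) ^ n - m) ^ 2
      ≤ ∑ y ∈ univ.filter (fun y => m ≤ (G y : ℝ)), lawAt P (Pi.single x₀ 1) n y := by
  have hind : ∀ i j, i ≤ j → j ≤ K → (fun k : ℕ => if m ≤ (k : ℝ) then (1 : ℝ) else 0) i ≤ (fun k : ℕ => if m ≤ (k : ℝ) then (1 : ℝ) else 0) j := by
    intro i j hij _
    simp only
    by_cases hi : m ≤ (i : ℝ)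
    · have hj : m ≤ (j : ℝ) := le_trans hi (by exact_mod_cast hij)
      rw [if_pos hi, if_pos hj]
    · rw [if_neg hi]; split_ifs <;> norm_num
  have hμ0 : ∀ x, 0 ≤ (Pi.single x₀ (1 : ℝ) : X → ℝ) x := fun x => by by_cases h : x = x₀ <;> simp [h]
  have h1 := compare_lawAt hQ hθ0 hθK hP hGK hdrop hdown n hind hμ0
  have e1 : ∑ x, (Pi.single x₀ (1 : ℝ) : X → ℝ) x * (Q^[n] (fun k : ℕ => if m ≤ (k : ℝ) then (1 : ℝ) else 0)) (G x)
      = (Q^[n] (fun k : ℕ => if m ≤ (k : ℝ) then (1 : ℝ) else 0)) (G x₀) := by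
    rw [Finset.sum_eq_single x₀ (fun x _ hx => by simp [hx]) (fun h => absurd (mem_univ _) h)]; simp
  have e2 : ∑ y, lawAt P (Pi.single x₀ 1) n y * (fun k : ℕ => if m ≤ (k : ℝ) then (1 : ℝ) else 0) (G y)
      = ∑ y ∈ univ.filter (fun y => m ≤ (G y : ℝ)), lawAt P (Pi.single x₀ 1) n y := by
    rw [Finset.sum_filter]; exact sum_congr rfl fun y _ => by simp only [mul_ite, mul_one, mul_zero]
  rw [e1, e2] at h1
  exact le_trans (death_iter_indicator_ge hQ hθ0 hθh hθK (hGK x₀) n hms) h1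

/-! ## §4 The floors -/

/-- **THE DISTANCE FLOOR:** for every `g ≥ G`, every unit-mass `π ≥ 0`, with `s = G(x₀)(1−θ)ⁿ` and `m < s`:
**`d(n) ≥ ‖δ_{x₀}Pⁿ − π‖_TV ≥ 1 − s/(s−m)² − π{x : m ≤ g x}`**. [ours] -/
theorem compare_worstTvDist_ge (hQ : ∀ f j, Q f j = θ * j * f (j - 1) + (1 - θ * j) * f j) (hθ0 : 0 ≤ θ) (hθh : 2 * θ ≤ 1) (hθK : θ * K ≤ 1)
    (hP : IsRowStochastic P) (hGK : ∀ x, G x ≤ K) (hdrop : ∀ x y, P x y ≠ 0 → G x ≤ G y + 1)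
    (hdown : ∀ x, ∑ y ∈ univ.filter (fun y => G y + 1 = G x), P x y ≤ θ * G x) {g : X → ℝ} (hg : ∀ x, (G x : ℝ) ≤ g x)
    {π : X → ℝ} (hπ0 : ∀ x, 0 ≤ π x) (hπ1 : ∑ x, π x = 1) (x₀ : X) (n : ℕ) {m : ℝ} (hms : m < (G x₀ : ℝ) * (1 - θ) ^ n) :
    1 - (G x₀ : ℝ) * (1 - θ) ^ n / ((G x₀ : ℝ) * (1 - θ) ^ n - m) ^ 2 - ∑ x ∈ univ.filter (fun x => m ≤ g x), π x
      ≤ worstTvDist P π n := by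
  have hmass := compare_mass_ge hQ hθ0 hθh hθK hP hGK hdrop hdown x₀ n hms
  have hl1 : ∑ y, lawAt P (Pi.single x₀ (1 : ℝ)) n y = ∑ x, π x := by rw [sum_lawAt hP, Finset.sum_pi_single', if_pos (mem_univ _), hπ1]
  have htv := sub_sum_le_tvDist hl1 (univ.filter (fun y => m ≤ (G y : ℝ)))
  have hmono : ∑ x ∈ univ.filter (fun x => m ≤ (G x : ℝ)), π x ≤ ∑ x ∈ univ.filter (fun x => m ≤ g x), π x :=
    sum_le_sum_of_subset_of_nonneg (fun x hx => by
      rw [mem_filter] at hx ⊢; exact ⟨hx.1, le_trans hx.2 (hg x)⟩) fun x _ _ => hπ0 x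
  have hw := tvDist_single_le_worstTvDist P π n x₀
  linarith

/-- **BEFORE THE COUPON-COLLECTOR TIME THE CHAIN IS FAR FROM `π`:** if `G(x₀)(1−θ)ⁿ ≥ 3(e+2)` where `E_π g ≤ e` (`g ≥ G`, `π` a stationary probability vector, the chain
`¼`-close at some time), then **`n < t_mix(1/4)`** (indeed `d(n) ≥ 1/3`). [ours] -/
theorem compare_lt_mixingTime (hQ : ∀ f j, Q f j = θ * j * f (j - 1) + (1 - θ * j) * f j) (hθ0 : 0 ≤ θ) (hθh : 2 * θ ≤ 1) (hθK : θ * K ≤ 1)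
    (hP : IsRowStochastic P) (hGK : ∀ x, G x ≤ K) (hdrop : ∀ x y, P x y ≠ 0 → G x ≤ G y + 1)
    (hdown : ∀ x, ∑ y ∈ univ.filter (fun y => G y + 1 = G x), P x y ≤ θ * G x) {g : X → ℝ} (hg : ∀ x, (G x : ℝ) ≤ g x)
    {π : X → ℝ} (hπ0 : ∀ x, 0 ≤ π x) (hπ1 : ∑ x, π x = 1) (hst : IsStationary π P) {e : ℝ} (he : ∑ x, π x * g x ≤ e)
    (hmix : ∃ t₀, worstTvDist P π t₀ ≤ 1 / 4) (x₀ : X) {n : ℕ} (hn : 3 * (e + 2) ≤ (G x₀ : ℝ) * (1 - θ) ^ n) :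
    n < mixingTime P π (1 / 4) := by
  have hg0 : ∀ x, 0 ≤ g x := fun x => le_trans (Nat.cast_nonneg _) (hg x)
  set s : ℝ := (G x₀ : ℝ) * (1 - θ) ^ n with hs
  have he0 : 0 ≤ e := le_trans (sum_nonneg fun x _ => mul_nonneg (hπ0 x) (hg0 x)) he
  have hs6 : 6 ≤ s := by linarith
  have hspos : 0 < s := by linarith
  -- the floor at `m = s/2`
  have hfloor := compare_worstTvDist_ge hQ hθ0 hθh hθK hP hGK hdrop hdown hg hπ0 hπ1 x₀ n (m := s / 2) (by linarith)
  have e1 : s / (s - s / 2) ^ 2 = 4 / s := by field_simp; ring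
  rw [e1] at hfloor
  -- Markov under `π`: `π{g ≥ s/2} ≤ 2e/s`
  have hMarkov : ∑ x ∈ univ.filter (fun x => s / 2 ≤ g x), π x ≤ 2 * e / s := by
    rw [le_div_iff₀ hspos]
    have h1 : (∑ x ∈ univ.filter (fun x => s / 2 ≤ g x), π x) * (s / 2) ≤ ∑ x ∈ univ.filter (fun x => s / 2 ≤ g x), π x * g x := by
      rw [sum_mul]; exact sum_le_sum fun x hx => mul_le_mul_of_nonneg_left (mem_filter.mp hx).2 (hπ0 x)
    have h2 : ∑ x ∈ univ.filter (fun x => s / 2 ≤ g x), π x * g x ≤ ∑ x, π x * g x :=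
      sum_le_sum_of_subset_of_nonneg (filter_subset _ _) fun x _ _ => mul_nonneg (hπ0 x) (hg0 x)
    linarith
  have hbad : (4 + 2 * e) / s ≤ 2 / 3 := by
    rw [div_le_iff₀ hspos]; linarith
  have hsplit : 4 / s + 2 * e / s = (4 + 2 * e) / s := by field_simp
  by_contra hcon
  push Not at hcon
  obtain ⟨t₀, ht₀⟩ := hmix
  have hd := worstTvDist_le_of_mixingTime_le hP hst ht₀ hcon
  linarith

/-- **THE COUPON-COLLECTOR MIXING FLOOR, as printed:** under the same hypotheses with `0 < θ` and `0 < G(x₀)`, **`t_mix(1/4) ≥ ((1−θ)/θ)·log(G(x₀)/(3(e+2)))`**.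
[ours] -/
theorem compare_mixingTime_ge (hQ : ∀ f j, Q f j = θ * j * f (j - 1) + (1 - θ * j) * f j) (hθ0 : 0 < θ) (hθh : 2 * θ ≤ 1)
    (hθK : θ * K ≤ 1) (hP : IsRowStochastic P) (hGK : ∀ x, G x ≤ K) (hdrop : ∀ x y, P x y ≠ 0 → G x ≤ G y + 1)
    (hdown : ∀ x, ∑ y ∈ univ.filter (fun y => G y + 1 = G x), P x y ≤ θ * G x) {g : X → ℝ} (hg : ∀ x, (G x : ℝ) ≤ g x)
    {π : X → ℝ} (hπ0 : ∀ x, 0 ≤ π x) (hπ1 : ∑ x, π x = 1) (hst : IsStationary π P) {e : ℝ} (he : ∑ x, π x * g x ≤ e)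
    (hmix : ∃ t₀, worstTvDist P π t₀ ≤ 1 / 4) (x₀ : X) (hx₀ : 0 < G x₀) :
    (1 - θ) / θ * Real.log ((G x₀ : ℝ) / (3 * (e + 2))) ≤ (mixingTime P π (1 / 4) : ℝ) := by
  have hθ1 : θ < 1 := by linarith
  have hg0 : ∀ x, 0 ≤ g x := fun x => le_trans (Nat.cast_nonneg _) (hg x)
  have he0 : 0 ≤ e := le_trans (sum_nonneg fun x _ => mul_nonneg (hπ0 x) (hg0 x)) he
  have hG0 : (0 : ℝ) < G x₀ := by exact_mod_cast hx₀
  have hC : (0 : ℝ) < 3 * (e + 2) := by linarith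
  by_contra h
  push Not at h
  set n := mixingTime P π (1 / 4) with hn
  -- `n ≤ ((1−θ)/θ)·log(G(x₀)/(3(e+2)))` gives `G(x₀)(1−θ)ⁿ ≥ 3(e+2)`
  have h1 : (n : ℝ) * θ / (1 - θ) ≤ Real.log ((G x₀ : ℝ) / (3 * (e + 2))) := by
    have h1θ : 0 < 1 - θ := by linarith
    have := mul_le_mul_of_nonneg_left h.le (div_pos hθ0 h1θ).le
    have e1 : θ / (1 - θ) * ((1 - θ) / θ * Real.log ((G x₀ : ℝ) / (3 * (e + 2)))) = Real.log ((G x₀ : ℝ) / (3 * (e + 2))) := by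
      field_simp
    have e2 : θ / (1 - θ) * (n : ℝ) = n * θ / (1 - θ) := by ring
    rw [e1, e2] at this
    exact this
  have h2 : 3 * (e + 2) ≤ (G x₀ : ℝ) * (1 - θ) ^ n := by
    calc 3 * (e + 2) = (G x₀ : ℝ) * Real.exp (-Real.log ((G x₀ : ℝ) / (3 * (e + 2)))) := by
          rw [Real.exp_neg, Real.exp_log (div_pos hG0 hC)]; field_simp
      _ ≤ (G x₀ : ℝ) * Real.exp (-(n * θ / (1 - θ))) := mul_le_mul_of_nonneg_left (Real.exp_le_exp.mpr (neg_le_neg h1)) hG0.le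
      _ ≤ (G x₀ : ℝ) * (1 - θ) ^ n := mul_le_mul_of_nonneg_left (one_sub_pow_ge_exp hθ1 n) hG0.le
  have := compare_lt_mixingTime hQ hθ0.le hθh hθK hP hGK hdrop hdown hg hπ0 hπ1 hst he hmix x₀ h2
  exact lt_irrefl _ this

end Compare

end Summit.Ventures.LatticeQCDFlow.Scaling

end
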